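import Summits.Ventures.DiscreteObjects.UnitDistance.LineCayleyHoffman
import Summits.Ventures.DiscreteObjects.UnitDistance.UnitQuadranceF243Trace
import HarnessLib

/-!
# `χ(UD(F₂₄₃²)) ≥ 10` in the kernel: the residue field `q = 243` is not a killer (lines Hoffman bound, `α ≤ 6272`)

Framing (verbatim for the cell): lottery ticket; floor = certified bounds/negative ranges.

The (U) reduction atlas bounds `χ(K²)` by `χ(unitCircleGraph k)` for every residue field `k` of `K` with `|k| = q ≡ 3 (mod 4)`; a residue
field is a 'killer' when that chromatic number is `≤ 5`.  The census decided `q = 243 = 3⁵` OUTSIDE Lean (exact spectrum, `λ_min = −29`).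
This file proves it INSIDE the kernel, as an instance of the elementary Hoffman bound for Cayley graphs of lines (`LineCayleyHoffman.lean`):
`UD(F₂₄₃²) = Cay(F₃¹⁰, 122 lines)`, `D` = the 244 circle vectors, `m = 62`:

  `α · (244 − 62) · 3 ≤ 3¹⁰ · (244 − 3·62)`, i.e. `546 α ≤ 3424842`, `α(unitCircleGraph F) ≤ 6272` for every field `F` with 243 elements,

hence `χ ≥ 10` (`9 · 6272 = 56448 < 59049`), in particular `χ ≥ 6`: `F₂₄₃` is NOT a killer residue field (kernel).

THE ONE NON-TRIVIAL HYPOTHESIS — every non-zero functional on `F₃¹⁰` vanishes on `≥ 62` circle vectors — is reduced from `3¹⁰ − 1 = 59048`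
functionals to the 242 NORM CLASSES: (1) the functionals `s ↦ ⟨c, s⟩ = Tr(c₁s₁ + c₂s₂)` (`pairV`, `UnitQuadranceF243Trace.lean`) are, in
coordinates, `s ↦ tauV c ⬝ᵥ coordV243 s`, and `c ↦ tauV c` is a bijection `F₂₄₃² → F₃¹⁰` (injective by a kernel check of its kernel, then
counting); (2) `⟨r ⊙ w, s⟩ = ⟨r, ρ_w s⟩` for the 'complex' product `⊙` and the rotation `ρ_w`, which permutes the circle when `w₁² + w₂² = 1`,
so the count for `c = r ⊙ w` is at least the count for `r`; (3) every `c ≠ 0` is `repOf(c₁² + c₂²) ⊙ w` with `w` on the circle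
(`x² + y²` is anisotropic and multiplicative).  The count `≥ 62` for the 242 representatives is the kernel fact `sixtyTwo_le_count_repOf`.
The second hypothesis (a non-zero vector off the circle is on no circle line) is pure algebra here: `F₃`-multiples are `0, ±t` and
`x² + y²` is even.  Seat udg g8 (zero farm); generator of the data files `code/udg8/gen_f243_lean.py`.
-/

namespace Summit.Ventures.DiscreteObjects.UnitDistance

open SimpleGraph Finset F243

/-! ## 1. Coordinates `F243 × F243 = F₃¹⁰` -/

/-- The ten `F₃`-coordinates of a point of `F243 × F243`. -/
def coordV243 (x : F243 × F243) : Fin 10 → ZMod 3 :=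
  ![x.1.a, x.1.b, x.1.c, x.1.d, x.1.e, x.2.a, x.2.b, x.2.c, x.2.d, x.2.e]

/-- Inverse coordinate map. -/
def ofCoordV243 (v : Fin 10 → ZMod 3) : F243 × F243 := (⟨v 0, v 1, v 2, v 3, v 4⟩, ⟨v 5, v 6, v 7, v 8, v 9⟩)

/-- `ofCoordV243 ∘ coordV243 = id`. -/
theorem ofCoordV243_coordV243 (x : F243 × F243) : ofCoordV243 (coordV243 x) = x := by
  obtain ⟨⟨_, _, _, _, _⟩, ⟨_, _, _, _, _⟩⟩ := x
  rfl

/-- `coordV243 ∘ ofCoordV243 = id`. -/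
theorem coordV243_ofCoordV243 (v : Fin 10 → ZMod 3) : coordV243 (ofCoordV243 v) = v := by
  ext i
  fin_cases i <;> rfl

/-- `coordV243` is injective. -/
theorem coordV243_injective : Function.Injective coordV243 := fun x y h => by
  rw [← ofCoordV243_coordV243 x, h, ofCoordV243_coordV243]

/-- `ofCoordV243` is injective. -/
theorem ofCoordV243_injective : Function.Injective ofCoordV243 := fun x y h => by
  rw [← coordV243_ofCoordV243 x, h, coordV243_ofCoordV243]

/-- `coordV243` is additive. -/
theorem coordV243_sub (x y : F243 × F243) : coordV243 (x - y) = coordV243 x - coordV243 y := by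
  ext i
  fin_cases i <;> simp [coordV243, F243.add_def, F243.neg_def, sub_eq_add_neg]

/-- `coordV243 0 = 0`. -/
theorem coordV243_zero : coordV243 0 = 0 := by
  ext i
  fin_cases i <;> rfl

/-- Raw scalar multiplication by `k ∈ F₃` (componentwise on the ten coordinates). -/
def smulV243 (k : ZMod 3) (x : F243 × F243) : F243 × F243 :=
  (⟨k * x.1.a, k * x.1.b, k * x.1.c, k * x.1.d, k * x.1.e⟩, ⟨k * x.2.a, k * x.2.b, k * x.2.c, k * x.2.d, k * x.2.e⟩)

/-- `coordV243 (smulV243 k x) = k • coordV243 x`. -/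
theorem coordV243_smulV243 (k : ZMod 3) (x : F243 × F243) : coordV243 (smulV243 k x) = k • coordV243 x := by
  ext i
  fin_cases i <;> simp [coordV243, smulV243]

/-- `0 • x = 0` in raw form. -/
theorem smulV243_zero (x : F243 × F243) : smulV243 0 x = 0 := by
  simp only [smulV243, zero_mul]
  rfl

/-- `1 • x = x` in raw form. -/
theorem smulV243_one (x : F243 × F243) : smulV243 1 x = x := by
  obtain ⟨⟨_, _, _, _, _⟩, ⟨_, _, _, _, _⟩⟩ := x
  simp only [smulV243, one_mul]

/-- `2 • x = −x` in raw form (`2 = −1` in `F₃`). -/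
theorem smulV243_two (x : F243 × F243) : smulV243 2 x = -x := by
  have hneg : -x = (⟨-x.1.a, -x.1.b, -x.1.c, -x.1.d, -x.1.e⟩, ⟨-x.2.a, -x.2.b, -x.2.c, -x.2.d, -x.2.e⟩) := rfl
  have h2 : ∀ z : ZMod 3, 2 * z = -z := by decide
  rw [hneg]
  simp only [smulV243, h2]

/-- The three `F₃`-multiples of a vector are `0`, `x`, `−x`. -/
theorem smulV243_cases (k : ZMod 3) (x : F243 × F243) : smulV243 k x = 0 ∨ smulV243 k x = x ∨ smulV243 k x = -x := by
  fin_cases k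
  · exact Or.inl (smulV243_zero x)
  · exact Or.inr (Or.inl (smulV243_one x))
  · exact Or.inr (Or.inr (smulV243_two x))

/-! ## 2. Functionals via the trace pairing: `tauV` -/

/-- The coordinate vector of the functional `s ↦ ⟨c, s⟩ = Tr(c₁ s₁ + c₂ s₂)` (read off from `2·(c s)₀ + (c s)₄`). -/
def tauV (c : F243 × F243) : Fin 10 → ZMod 3 :=
  ![2 * c.1.a + c.1.e, c.1.d - 2 * c.1.e, c.1.c - 2 * c.1.d, c.1.b - 2 * c.1.c, c.1.a - 2 * c.1.b + c.1.e,
    2 * c.2.a + c.2.e, c.2.d - 2 * c.2.e, c.2.c - 2 * c.2.d, c.2.b - 2 * c.2.c, c.2.a - 2 * c.2.b + c.2.e]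

/-- `tauV c ⬝ᵥ coordV243 s = ⟨c, s⟩` (a polynomial identity). -/
theorem tauV_dotProduct (c s : F243 × F243) : tauV c ⬝ᵥ coordV243 s = pairV c s := by
  simp only [dotProduct, Fin.sum_univ_succ, Fin.sum_univ_zero, tauV, coordV243, pairV, trV, F243.add, F243.mul,
    Matrix.cons_val_zero, Matrix.cons_val_succ]
  simp
  ring

/-- `tauV` is additive. -/
theorem tauV_sub (c c' : F243 × F243) : tauV (c - c') = tauV c - tauV c' := by
  ext i
  fin_cases i <;> simp [tauV, F243.add_def, F243.neg_def, sub_eq_add_neg] <;> ring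

/-- The same functional vector packaged as a point of `F243 × F243` (for a kernel-cheap injectivity check). -/
def tauRaw (c : F243 × F243) : F243 × F243 :=
  (⟨2 * c.1.a + c.1.e, c.1.d - 2 * c.1.e, c.1.c - 2 * c.1.d, c.1.b - 2 * c.1.c, c.1.a - 2 * c.1.b + c.1.e⟩,
   ⟨2 * c.2.a + c.2.e, c.2.d - 2 * c.2.e, c.2.c - 2 * c.2.d, c.2.b - 2 * c.2.c, c.2.a - 2 * c.2.b + c.2.e⟩)

/-- `tauV = coordV243 ∘ tauRaw`. -/
theorem tauV_eq_coordV243_tauRaw (c : F243 × F243) : tauV c = coordV243 (tauRaw c) := by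
  ext i
  fin_cases i <;> rfl

/-- KERNEL FACT: `tauRaw` has trivial kernel (`3¹⁰` evaluations in raw arithmetic). -/
theorem tauRaw_eq_zero : ∀ c : F243 × F243, tauRaw c = 0 → c = 0 := by
  decide +kernel

/-- Hence `tauV` has trivial kernel. -/
theorem tauV_eq_zero (c : F243 × F243) (h : tauV c = 0) : c = 0 := by
  rw [tauV_eq_coordV243_tauRaw, ← coordV243_zero] at h
  exact tauRaw_eq_zero c (coordV243_injective h)

/-- `tauV 0 = 0`. -/
theorem tauV_zero : tauV 0 = 0 := by
  rw [tauV_eq_coordV243_tauRaw, ← coordV243_zero]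
  rfl

/-- `tauV` is a bijection `F₂₄₃² → F₃¹⁰` (injective with trivial kernel; equal cardinalities `3¹⁰`). -/
theorem tauV_bijective : Function.Bijective tauV := by
  rw [Fintype.bijective_iff_injective_and_card]
  refine ⟨fun c c' h => ?_, ?_⟩
  · have h0 : tauV (c - c') = 0 := by rw [tauV_sub, h, sub_self]
    exact sub_eq_zero.mp (tauV_eq_zero _ h0)
  · simp [Fintype.card_prod, F243.card_eq, ZMod.card]

/-! ## 3. The circle group acts: counts depend only on the norm class -/

/-- 'Complex' multiplication on `F243 × F243 = F₂₄₃(i)`: `(c₁ + c₂ i)(w₁ + w₂ i)`. -/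
def cmulV (c w : F243 × F243) : F243 × F243 := (c.1 * w.1 - c.2 * w.2, c.1 * w.2 + c.2 * w.1)

/-- The transpose action on arguments: `⟨c ⊙ w, s⟩ = ⟨c, ρ_w s⟩` with `ρ_w s = (w₁s₁ + w₂s₂, w₁s₂ − w₂s₁)`. -/
def rhoV (w s : F243 × F243) : F243 × F243 := (w.1 * s.1 + w.2 * s.2, w.1 * s.2 - w.2 * s.1)

/-- The inverse rotation (when `w₁² + w₂² = 1`): `ρ'_w s = (w₁s₁ − w₂s₂, w₁s₂ + w₂s₁)`. -/
def rhoInvV (w s : F243 × F243) : F243 × F243 := (w.1 * s.1 - w.2 * s.2, w.1 * s.2 + w.2 * s.1)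

/-- `⟨c ⊙ w, s⟩ = ⟨c, ρ_w s⟩`. -/
theorem pairV_cmulV (c w s : F243 × F243) : pairV (cmulV c w) s = pairV c (rhoV w s) := by
  show trV ((cmulV c w).1 * s.1 + (cmulV c w).2 * s.2) = trV (c.1 * (rhoV w s).1 + c.2 * (rhoV w s).2)
  congr 1
  simp only [cmulV, rhoV]
  ring

/-- `ρ_w ∘ ρ'_w = id` on the circle `w₁² + w₂² = 1`. -/
theorem rhoV_rhoInvV {w : F243 × F243} (hw : w.1 ^ 2 + w.2 ^ 2 = 1) (s : F243 × F243) : rhoV w (rhoInvV w s) = s := by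
  obtain ⟨s1, s2⟩ := s
  simp only [rhoV, rhoInvV, Prod.mk.injEq]
  constructor
  · linear_combination s1 * hw
  · linear_combination s2 * hw

/-- `ρ'_w` preserves the circle when `w` is on it (the quadrance is multiplicative). -/
theorem quad_rhoInvV {w : F243 × F243} (hw : w.1 ^ 2 + w.2 ^ 2 = 1) {s : F243 × F243} (hs : s.1 ^ 2 + s.2 ^ 2 = 1) :
    (rhoInvV w s).1 ^ 2 + (rhoInvV w s).2 ^ 2 = 1 := by
  simp only [rhoInvV]
  linear_combination (s.1 ^ 2 + s.2 ^ 2) * hw + hs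

/-- The circle as a finset and the set of circle points killed by `⟨c, ·⟩`. -/
def killSet243 (c : F243 × F243) : Finset (F243 × F243) := ud243Circle.toFinset.filter fun s => pairV c s = 0

/-- Membership in the circle finset is the quadrance condition. -/
theorem mem_circle_toFinset {s : F243 × F243} : s ∈ ud243Circle.toFinset ↔ s.1 ^ 2 + s.2 ^ 2 = 1 := by
  rw [List.mem_toFinset]
  constructor
  · intro h
    rw [← quadRaw243_eq, quadRaw243_of_mem h]
    rfl
  · exact mem_ud243Circle s

/-- `killCount243 c = |killSet243 c|` (the list has no duplicates). -/
theorem killCount243_eq_card (c : F243 × F243) : killCount243 c = #(killSet243 c) := by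
  rw [killCount243, ← List.toFinset_card_of_nodup (ud243Circle_nodup.filter _), List.toFinset_filter, killSet243]
  simp only [decide_eq_true_eq]

/-- INVARIANCE (as an inequality): for `w` on the circle, `|killSet (r ⊙ w)| ≥ |killSet r|` (`ρ'_w` injects one into the other). -/
theorem card_killSet243_le_cmulV (r : F243 × F243) {w : F243 × F243} (hw : w.1 ^ 2 + w.2 ^ 2 = 1) :
    #(killSet243 r) ≤ #(killSet243 (cmulV r w)) := by
  classical
  have hinj : Set.InjOn (rhoInvV w) (killSet243 r : Set (F243 × F243)) := by
    intro s _ s' _ h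
    have := congrArg (rhoV w) h
    rwa [rhoV_rhoInvV hw, rhoV_rhoInvV hw] at this
  rw [← Finset.card_image_of_injOn hinj]
  refine Finset.card_le_card fun x hx => ?_
  rw [Finset.mem_image] at hx
  obtain ⟨s, hs, rfl⟩ := hx
  rw [killSet243, Finset.mem_filter, mem_circle_toFinset] at hs ⊢
  refine ⟨quad_rhoInvV hw hs.1, ?_⟩
  rw [pairV_cmulV, rhoV_rhoInvV hw]
  exact hs.2

/-! ## 4. Every non-zero `c` is a representative times a circle element -/

/-- Algebra of the representation `c = r ⊙ w`: with `r₁² + r₂² = c₁² + c₂² = ν` and `ν·νi = 1`, the vector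
`w = (c ⊙ r̄)·νi` is on the circle and `r ⊙ w = c`. -/
theorem exists_cmulV_of_quad_eq {c r : F243 × F243} {νi : F243} (hrq : r.1 ^ 2 + r.2 ^ 2 = c.1 ^ 2 + c.2 ^ 2)
    (hνi : (c.1 ^ 2 + c.2 ^ 2) * νi = 1) : ∃ w : F243 × F243, w.1 ^ 2 + w.2 ^ 2 = 1 ∧ cmulV r w = c := by
  refine ⟨((c.1 * r.1 + c.2 * r.2) * νi, (c.2 * r.1 - c.1 * r.2) * νi), ?_, Prod.ext ?_ ?_⟩
  · show ((c.1 * r.1 + c.2 * r.2) * νi) ^ 2 + ((c.2 * r.1 - c.1 * r.2) * νi) ^ 2 = 1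
    linear_combination (νi ^ 2 * (c.1 ^ 2 + c.2 ^ 2)) * hrq + ((c.1 ^ 2 + c.2 ^ 2) * νi + 1) * hνi
  · show r.1 * ((c.1 * r.1 + c.2 * r.2) * νi) - r.2 * ((c.2 * r.1 - c.1 * r.2) * νi) = c.1
    linear_combination (c.1 * νi) * hrq + c.1 * hνi
  · show r.1 * ((c.2 * r.1 - c.1 * r.2) * νi) + r.2 * ((c.1 * r.1 + c.2 * r.2) * νi) = c.2
    linear_combination (c.2 * νi) * hrq + c.2 * hνi

/-- A non-zero vector has non-zero quadrance (anisotropy). -/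
theorem quad_ne_zero_of_ne_zero {c : F243 × F243} (hc : c ≠ 0) : c.1 ^ 2 + c.2 ^ 2 ≠ 0 := fun h =>
  hc (Prod.ext (F243.sq_add_sq_eq_zero h).1 (F243.sq_add_sq_eq_zero h).2)

/-- An inverse of the quadrance, as an element (keeps `⁻¹` out of the polynomial identities). -/
theorem exists_quad_mul_eq_one {c : F243 × F243} (hν0 : c.1 ^ 2 + c.2 ^ 2 ≠ 0) :
    ∃ νi : F243, (c.1 ^ 2 + c.2 ^ 2) * νi = 1 :=
  ⟨_, mul_inv_cancel₀ hν0⟩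

/-- The representative of the norm class of `c`, as an abstract pair with the right quadrance. -/
theorem exists_repOf_eq {c : F243 × F243} (h : quadRaw243 (repOf (c.1 ^ 2 + c.2 ^ 2)) = c.1 ^ 2 + c.2 ^ 2) :
    ∃ r : F243 × F243, repOf (c.1 ^ 2 + c.2 ^ 2) = r ∧ r.1 ^ 2 + r.2 ^ 2 = c.1 ^ 2 + c.2 ^ 2 := by
  generalize repOf (c.1 ^ 2 + c.2 ^ 2) = r at h ⊢
  rw [quadRaw243_eq] at h
  exact ⟨r, rfl, h⟩

/-- For `c ≠ 0` with `ν = c₁² + c₂²`: `c = repOf ν ⊙ w` for some `w` on the circle. -/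
theorem exists_cmulV_repOf {c : F243 × F243} (hc : c ≠ 0) :
    ∃ w : F243 × F243, w.1 ^ 2 + w.2 ^ 2 = 1 ∧ cmulV (repOf (c.1 ^ 2 + c.2 ^ 2)) w = c := by
  have hν0 := quad_ne_zero_of_ne_zero hc
  obtain ⟨νi, hνi⟩ := exists_quad_mul_eq_one hν0
  obtain ⟨r, hr, hrq⟩ := exists_repOf_eq (quad_repOf _ hν0)
  rw [hr]
  exact exists_cmulV_of_quad_eq hrq hνi

/-- Hence EVERY non-zero `c` kills at least 62 circle points. -/
theorem sixtyTwo_le_card_killSet243 {c : F243 × F243} (hc : c ≠ 0) : 62 ≤ #(killSet243 c) := by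
  obtain ⟨w, hw, hcw⟩ := exists_cmulV_repOf hc
  have h := sixtyTwo_le_count_repOf _ (quad_ne_zero_of_ne_zero hc)
  rw [killCount243_eq_card] at h
  rw [← hcw]
  exact h.trans (card_killSet243_le_cmulV _ hw)

/-! ## 5. The hypotheses of `indepNum_bound_of_lines` -/

/-- The 244 circle vectors in coordinates. -/
def circleDirs243 : Finset (Fin 10 → ZMod 3) := ud243Circle.toFinset.image coordV243

/-- `|circleDirs243| = 244`. -/
theorem card_circleDirs243 : #circleDirs243 = 244 := by
  rw [circleDirs243, Finset.card_image_of_injective _ coordV243_injective, List.toFinset_card_of_nodup ud243Circle_nodup,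
    ud243Circle_length]

/-- Membership in `circleDirs243`. -/
theorem mem_circleDirs243_iff {d : Fin 10 → ZMod 3} : d ∈ circleDirs243 ↔ ∃ s, s.1 ^ 2 + s.2 ^ 2 = 1 ∧ coordV243 s = d := by
  simp only [circleDirs243, Finset.mem_image, mem_circle_toFinset]

/-- Directions are non-zero. -/
theorem circleDirs243_ne_zero : ∀ d ∈ circleDirs243, d ≠ 0 := by
  intro d hd h
  obtain ⟨s, hs, rfl⟩ := mem_circleDirs243_iff.mp hd
  rw [← coordV243_zero] at h
  have hs0 := coordV243_injective h
  rw [hs0] at hs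
  simp at hs

/-- HYPOTHESIS (m = 62): every non-zero functional on `F₃¹⁰` kills at least 62 of the 244 circle vectors. -/
theorem sixtyTwo_le_killCount (a : Fin 10 → ZMod 3) (ha : a ≠ 0) : 62 ≤ killCount circleDirs243 a := by
  obtain ⟨c, rfl⟩ := tauV_bijective.2 a
  have hc : c ≠ 0 := by
    rintro rfl
    exact ha tauV_zero
  unfold killCount circleDirs243
  rw [Finset.filter_image, Finset.card_image_of_injective _ coordV243_injective]
  have hset : ud243Circle.toFinset.filter (fun s => tauV c ⬝ᵥ coordV243 s = 0) = killSet243 c :=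
    Finset.filter_congr fun s _ => by rw [tauV_dotProduct]
  rw [hset]
  exact sixtyTwo_le_card_killSet243 hc

/-- The unit-quadrance graph of `F₂₄₃²` transported to `F₃¹⁰`. -/
def ud243Graph10 : SimpleGraph (Fin 10 → ZMod 3) := (unitCircleGraph F243).comap ofCoordV243

/-- HYPOTHESIS (lines): distinct non-adjacent vertices differ by a vector on no circle line (`F₃`-multiples are `0, ±t`; `x² + y²` is even). -/
theorem ud243Graph10_generic : ∀ x y : Fin 10 → ZMod 3, x ≠ y → ¬ ud243Graph10.Adj x y →
    ∀ d ∈ circleDirs243, (∀ k : ZMod 3, k • d ≠ x - y) ∧ (∀ k : ZMod 3, k • (x - y) ≠ d) := by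
  intro x y hxy hadj d hd
  obtain ⟨s, hs, rfl⟩ := mem_circleDirs243_iff.mp hd
  set t : F243 × F243 := ofCoordV243 x - ofCoordV243 y with ht
  have hxy' : ofCoordV243 x ≠ ofCoordV243 y := fun h => hxy (ofCoordV243_injective h)
  have ht0 : t ≠ 0 := sub_ne_zero.mpr hxy'
  have hct : coordV243 t = x - y := by rw [ht, coordV243_sub, coordV243_ofCoordV243, coordV243_ofCoordV243]
  have hq : t.1 ^ 2 + t.2 ^ 2 ≠ 1 := by
    intro h
    exact hadj ⟨hxy', by simpa only [ht, Prod.fst_sub, Prod.snd_sub] using h⟩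
  have hqneg : (-t).1 ^ 2 + (-t).2 ^ 2 = t.1 ^ 2 + t.2 ^ 2 := by simp only [Prod.fst_neg, Prod.snd_neg]; ring
  have hsneg : (-s).1 ^ 2 + (-s).2 ^ 2 = 1 := by rw [← hs]; simp only [Prod.fst_neg, Prod.snd_neg]; ring
  refine ⟨fun k hk => ?_, fun k hk => ?_⟩
  · rw [← hct, ← coordV243_smulV243] at hk
    have hk' := coordV243_injective hk
    rcases smulV243_cases k s with h0 | h1 | h2
    · exact ht0 (by rw [← hk', h0])
    · exact hq (by rw [← hk', h1, hs])
    · exact hq (by rw [← hk', h2, hsneg])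
  · rw [← hct, ← coordV243_smulV243] at hk
    have hk' := coordV243_injective hk
    rcases smulV243_cases k t with h0 | h1 | h2
    · rw [h0] at hk'
      rw [← hk'] at hs
      simp at hs
    · exact hq (by rw [← h1, hk', hs])
    · rw [h2] at hk'
      exact hq (by rw [← hqneg, hk', hs])

/-! ## 6. `α ≤ 6272`, transfer to every field with 243 elements, `χ ≥ 10` -/

/-- `α(ud243Graph10) ≤ 6272`: the lines bound with `|D| = 244`, `m = 62`: `546·α ≤ 3424842`. -/
theorem indepNum_ud243Graph10_le : ud243Graph10.indepNum ≤ 6272 := by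
  have h := indepNum_bound_of_lines circleDirs243 circleDirs243_ne_zero 62 sixtyTwo_le_killCount ud243Graph10_generic
  rw [card_circleDirs243] at h
  push_cast at h
  omega

/-- Independent sets of `unitCircleGraph F243` map to independent sets of the coordinate model. -/
theorem isIndepSet_ud243Graph10_map {A : Finset (F243 × F243)} (hA : (unitCircleGraph F243).IsIndepSet (A : Set (F243 × F243))) :
    ud243Graph10.IsIndepSet ((A.map ⟨coordV243, coordV243_injective⟩ : Finset (Fin 10 → ZMod 3)) : Set (Fin 10 → ZMod 3)) := by
  intro x hx y hy hxy hadj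
  rw [Finset.coe_map, Set.mem_image] at hx hy
  obtain ⟨x', hx', rfl⟩ := hx
  obtain ⟨y', hy', rfl⟩ := hy
  have hadj' : (unitCircleGraph F243).Adj x' y' := by
    have h := hadj
    simp only [ud243Graph10, SimpleGraph.comap_adj, Function.Embedding.coeFn_mk, ofCoordV243_coordV243] at h
    exact h
  exact hA hx' hy' (fun h => hxy (by rw [h])) hadj'

/-- `α(unitCircleGraph F243) ≤ 6272` (kernel). -/
theorem indepNum_unitCircleGraph_F243_le : (unitCircleGraph F243).indepNum ≤ 6272 := by
  classical
  obtain ⟨s, hs⟩ := (unitCircleGraph F243).exists_isNIndepSet_indepNum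
  rw [← hs.card_eq]
  have h := (isIndepSet_ud243Graph10_map hs.isIndepSet).card_le_indepNum
  rw [Finset.card_map] at h
  exact h.trans indepNum_ud243Graph10_le

/-- HOFFMAN BOUND IN THE KERNEL for `q = 243`: `α(unitCircleGraph F) ≤ 6272` for every field `F` with 243 elements
(`6272 = ⌊3⁹ · 29 / 91⌋`, the ratio bound for the smallest eigenvalue `−29`). -/
theorem indepNum_unitCircleGraph_le_6272_of_card_eq_243 (F : Type*) [Field F] [Fintype F] (hF : Fintype.card F = 243) :
    (unitCircleGraph F).indepNum ≤ 6272 := by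
  classical
  have e : F ≃+* F243 := FiniteField.ringEquivOfCardEq (by rw [hF, F243.card_eq])
  obtain ⟨s, hs⟩ := (unitCircleGraph F).exists_isNIndepSet_indepNum
  rw [← hs.card_eq]
  have h := (isIndepSet_map_of_ringEquiv e hs.isIndepSet).card_le_indepNum
  rw [Finset.card_map] at h
  exact h.trans indepNum_unitCircleGraph_F243_le

/-- ATLAS ROW `q = 243` IN THE KERNEL: `χ(unitCircleGraph F) ≥ 10` for every field with 243 elements (`9 · 6272 = 56448 < 59049 = 243²`). -/
theorem ten_le_chromaticNumber_unitCircleGraph_of_card_eq_243 (F : Type*) [Field F] [Fintype F] (hF : Fintype.card F = 243) :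
    (10 : ℕ∞) ≤ (unitCircleGraph F).chromaticNumber :=
  succ_le_chromaticNumber_unitCircleGraph_of_card (k := 9) hF (indepNum_unitCircleGraph_le_6272_of_card_eq_243 F hF) (by norm_num)

/-- In particular `χ ≥ 6`: `F₂₄₃` is NOT a killer residue field of the (U) reduction atlas (kernel; previously 'exact spectrum' outside Lean). -/
theorem six_le_chromaticNumber_unitCircleGraph_of_card_eq_243 (F : Type*) [Field F] [Fintype F] (hF : Fintype.card F = 243) :
    (6 : ℕ∞) ≤ (unitCircleGraph F).chromaticNumber :=
  le_trans (by norm_num) (ten_le_chromaticNumber_unitCircleGraph_of_card_eq_243 F hF)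

end Summit.Ventures.DiscreteObjects.UnitDistance
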